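import Summits.Ventures.CertifiedQuantumChemistry.Rows.LiebSingletBridge
import Summits.Ventures.CertifiedQuantumChemistry.Rows.SpinSectors
import Literature.MathematicalPhysics.QuantumLattice.HubbardSzSectorLadder
import Literature.MathematicalPhysics.QuantumLattice.HubbardSectorEnclosureCertificate
import HarnessLib

/-!
# Ventures/CertifiedQuantumChemistry — Rows/HubbardRingTVSectorOrdering.lean: the central sector
# `(n, n)` carries the `2n`-electron ground energy of every symmetric model, and on the half-filled even
# Hubbard ring (`U > 0`, `t ≠ 0`) every other `S_z` sector lies STRICTLY above it (Lieb 1989)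

HONEST FRAMING (verbatim): certified bounds for a stated model Hamiltonian in a stated basis; not a
claim about the real molecule beyond that model.

Seat rdm-B, ROWS courtesy file (theorems only; no `def`, no notation, no instance; zero compute). The
cell certifies the sector quantity `Model.energy F a b = E₀(H_F; N_α = a, N_β = b)` and files its ring
rows at the central sector `(n, n)` of the half-filled ring `L = 2n`. Two facts about the OTHER sectors
with the same electron number `a + b = 2n`:

* §1 is the tree's `Rows/SpinSectors.lean` (typer T-05): `Model.energy_le_energy_of_max_le` — for every
  symmetric model the sector energies are non-decreasing in `|N_α − N_β|` at fixed electron number, so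
  `E₀(H_F; n, n) ≤ E₀(H_F; a, b)` for `a + b = 2n` (recalled as `Model.energy_center_le`, one line).
* §2 (the half-filled even ring, `L = 2n ≥ 2`, `t ≠ 0`, `U > 0`, `a + b = 2n`, `a ≠ b`)
  **`hubbardRingTV_energy_center_lt`**: `E₀(hubbardRingTV (2n) t U; n, n) < E₀(hubbardRingTV (2n) t U; a, b)`
  — STRICT: by Lieb's second theorem (the tree's `LiebHalfFilled.exists_unit_groundState`: the
  `2n`-electron ground state is unique and a singlet, hence supported in the `S_z = 0` sector) a sector
  with `S_z = (a − b)/2 ≠ 0` cannot reach the ground energy: its ground eigenvector would be a multiple of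
  the singlet and at the same time orthogonal to it (`dotProduct_eq_zero_of_isInSector`). Corollaries
  `hubbardRingTV_energy_center_lt_succ` (`(n, n)` vs `(n+1, n−1)`: the lowest `S_z = 1` level — hence the
  lowest triplet — is strictly above the ground state on every finite even ring); the NON-strict
  transport of central LOWER rows to all sectors is the tree's `LowerRow.le_energy_of_sameN`.

READING: statements about the exact sector energies of the cell's own model object; nothing about the
relaxation values (`OPT_DQG(a, b)` is NOT ordered this way in general), no row is written or moved, no
value of record read. All PROVED (0 sorry, standard axioms); no definitions, no named facts.
References (docstring-only): E. H. Lieb, Phys. Rev. Lett. 62 (1989) 1201, Thm 2 (via the tree);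
E. H. Lieb, D. Mattis, J. Math. Phys. 3 (1962) 749 (ordering of energy levels — NOT used: only the
`S_z = 0` minimum and strictness from uniqueness are typed). Tree (REUSED): `Model.energy_le_energy_of_max_le`
(`Rows/SpinSectors`), `Model.groundEnergy_eq_energy` (`Rows/NSector`), `hubbardRingTV_hamiltonian_eq`, `ringGraph_connected`, `evenSites_bipartite`,
`card_compl_evenSites` (`Rows/LiebSingletBridge`), `LiebHalfFilled.exists_unit_groundState`,
`groundEnergyAt_le_of_sector_trial`, `groundEnergyAt_eq_minEnergyOn_szSector`,
`dotProduct_eq_zero_of_isInSector`, `exists_unit_eigen_sectorGroundEnergy`,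
`ThermodynamicLimit.groundEnergy_le_re_expect`, `mem_szSector_iff_isInSector`.
-/

noncomputable section

namespace Summit.Ventures.CertifiedQuantumChemistry

open Matrix Finset
open Literature.MathematicalPhysics.QuantumLattice Literature.MathematicalPhysics.QuantumChemistry
open Summit.Ventures.CertifiedQuantumChemistry.Hamiltonians
open scoped ComplexOrder

/-! ## §1 Every symmetric model: the central sector is the lowest with its electron number -/

section AnyModel

variable {k : ℕ}

/-- **The central sector is the lowest among the sectors with `2n` electrons** (every symmetric model,
`a + b = 2n`, `a, b ≤ k`): `E₀(H_F; n, n) ≤ E₀(H_F; a, b)` — the tree's `Model.energy_le_energy_of_max_le`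
(`Rows/SpinSectors.lean`) at `max n n = n ≤ max a b`. [folklore] -/
theorem Model.energy_center_le {F : Model k} (hF : F.IsSymmetric) {n a b : ℕ} (hab : a + b = 2 * n)
    (ha : a ≤ k) (hb : b ≤ k) : F.energy n n ≤ F.energy a b :=
  Model.energy_le_energy_of_max_le hF ha hb (by omega) (by rw [max_self]; omega)

end AnyModel

/-! ## §2 The half-filled even ring: every non-central sector is STRICTLY above (Lieb) -/

section Ring

/-- **STRICT SECTOR ORDERING ON THE HALF-FILLED EVEN RING** (`L = 2n ≥ 2`, `t ≠ 0`, `U > 0`): for every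
sector `(a, b)` with `a + b = 2n` and `a ≠ b`,
`E₀(hubbardRingTV (2n) t U; n, n) < E₀(hubbardRingTV (2n) t U; a, b)` — the unique `2n`-electron ground
state is a singlet (Lieb 1989, Thm 2, the tree's `LiebHalfFilled.exists_unit_groundState`), so it lies in
the `S_z = 0` sector and is orthogonal to every vector of a sector with `S_z ≠ 0`; a sector reaching the
ground energy would contain a ground eigenvector, which uniqueness forces to be a multiple of the
singlet — zero. [folklore] -/
theorem hubbardRingTV_energy_center_lt {n : ℕ} (hn : 1 ≤ n) {t U : ℚ} (ht : t ≠ 0) (hU : 0 < U) {a b : ℕ}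
    (hab : a + b = 2 * n) (hne : a ≠ b) :
    Model.energy (hubbardRingTV (2 * n) t U) n n < Model.energy (hubbardRingTV (2 * n) t U) a b := by
  have hF := hubbardRingTV_isSymmetric (2 * n) t U
  have ha : a ≤ 2 * n := by omega
  have hb : b ≤ 2 * n := by omega
  have ha' : a ≤ Fintype.card (Fin (2 * n)) := by rw [Fintype.card_fin]; exact ha
  have hb' : b ≤ Fintype.card (Fin (2 * n)) := by rw [Fintype.card_fin]; exact hb
  refine lt_of_le_of_ne (Model.energy_center_le hF hab ha hb) fun heq => ?_
  -- Lieb's unique singlet ground state of the `2n`-electron ring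
  obtain ⟨ψ, hψK, hψ1, hHψ, -, huniq, -⟩ := LiebHalfFilled.exists_unit_groundState
    (ringGraph_connected (by omega : 0 < 2 * n)) (evenSites (2 * n)) (evenSites_bipartite n)
    (card_compl_evenSites n) (t := (t : ℝ)) (U := (U : ℝ)) (by exact_mod_cast ht) (by exact_mod_cast hU)
  rw [Fintype.card_fin] at hψK hHψ huniq
  -- `ψ` lies in the central sector `(n, n)`
  have hψS : IsInSector n n ψ := by
    rw [← mem_szSector_iff_isInSector, show n + n = 2 * n by ring, sub_self, zero_div]
    exact hψK
  -- the `2n`-electron ground energy is `E₀(n, n)`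
  have hgs : groundEnergyAt (ringGraph (2 * n)) (t : ℝ) (U : ℝ) (2 * n) =
      Model.energy (hubbardRingTV (2 * n) t U) n n := by
    rw [groundEnergyAt_eq_minEnergyOn_szSector (ringGraph (2 * n)) _ _ (by rw [Fintype.card_fin]; omega),
      Model.energy, sectorGroundEnergy_def, hubbardRingTV_hamiltonian_eq, show n + n = 2 * n by ring,
      sub_self, zero_div]
  -- a ground eigenvector `φ` of the `(a, b)` sector
  obtain ⟨φ, hφ, hφ1, hHφ⟩ :=
    exists_unit_eigen_sectorGroundEnergy (hubbardRingTV_hamiltonian_isHermitian (2 * n) t U) ha' hb'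
  -- at the (supposedly equal) ground energy it is a `2n`-electron ground eigenvector of the graph Hamiltonian
  have hHφ' : hamiltonian (ringGraph (2 * n)) (t : ℝ) (U : ℝ) *ᵥ φ =
      ((groundEnergyAt (ringGraph (2 * n)) (t : ℝ) (U : ℝ) (2 * n) : ℝ) : ℂ) • φ := by
    rw [← hubbardRingTV_hamiltonian_eq, hgs, heq]
    exact hHφ
  have hφN : IsNParticle (2 * n) φ := by
    have h2 := hφ.isNParticle
    rwa [hab] at h2
  have hprop := huniq φ hφN hHφ'
  -- but `ψ ⟂ φ` (different sectors), so `φ = 0`, contradicting `‖φ‖ = 1`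
  have horth : star ψ ⬝ᵥ φ = 0 :=
    dotProduct_eq_zero_of_isInSector (fun h => hne (by omega)) hψS hφ
  rw [horth, zero_smul] at hprop
  rw [hprop, dotProduct_zero] at hφ1
  exact zero_ne_one hφ1

/-- **The lowest `S_z = 1` level is strictly above the ground state**:
`E₀(hubbardRingTV (2n) t U; n, n) < E₀(hubbardRingTV (2n) t U; n+1, n−1)` (`n ≥ 1`, `t ≠ 0`, `U > 0`) —
in particular the lowest triplet of the half-filled even ring lies strictly above its singlet ground
state (finite `L`; no statement about a gap that survives `L → ∞`). [folklore] -/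
theorem hubbardRingTV_energy_center_lt_succ {n : ℕ} (hn : 1 ≤ n) {t U : ℚ} (ht : t ≠ 0) (hU : 0 < U) :
    Model.energy (hubbardRingTV (2 * n) t U) n n < Model.energy (hubbardRingTV (2 * n) t U) (n + 1) (n - 1) :=
  hubbardRingTV_energy_center_lt hn ht hU (by omega) (by omega)

end Ring

end Summit.Ventures.CertifiedQuantumChemistry

end
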